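import Summits.AtomisticToContinuum.FouriersLaw.Theorems.PhononMeanFreePathIncoherentBoundedLeftEnergyDynkin
import Summits.AtomisticToContinuum.FouriersLaw.Theorems.PhononMeanFreePathIncoherentBoundedContactBound
import Summits.AtomisticToContinuum.FouriersLaw.Theorems.BondHeatUncertaintyLightConeBondHeatBondCorrelation

/-!
# `PhononMeanFreePath.IncoherentBounded` — the mixed (observable × bond current) Kubo identities

Helper file for item `stmt-AtomisticToContinuum-11815` (support `IncoherentBounded`, route `PhononMeanFreePath`,
sub-problem `FouriersLaw`). For the `(N+1)`-site pinned anharmonic chain between two Langevin baths at the same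
temperature `T` (`μ₀ = gibbsMeasure (N+1) T`, `K_s = transitionKernel (N+1) T T s`, CONSTRUCTED), the kinetic readings
`θ₀ = p₀² - T`, `θ_N = p_N² - T` of the two contacts, BLR's bond currents `j_i` (`OscillatorChain.bondCurrent`), the left
block energies `E_{≤i}` (`HardTether.leftEnergy`, `L E_{≤i} = γ(T - p₀²) - j_i`) and the item's cross kernel
`C_N(s) = ∫ θ₀ · K_s θ_N dμ₀`. For a CENTRED observable `f` of exponential class (continuous, `|f| ≤ C e^{H/(4T)}`,
`∫ f dμ₀ = 0`):

* `corr_centred_integrableOn` — `u ↦ ⟨f, K_u g⟩_{μ₀} ∈ L¹(0,∞)` for every continuous `g` of exponential class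
  (exponential mixing at fixed `N`);
* `leftEnergy_pairing_sub` — Duhamel: `⟨f, K_r E_{≤i}⟩ - ⟨f, E_{≤i}⟩ = -∫₀ʳ (γ⟨f, K_sθ₀⟩ + ⟨f, K_s j_i⟩) ds`;
* `integral_corr_current_eq` — **`∫₀^∞ ⟨f, K_s j_i⟩ ds = ⟨f, E_{≤i}⟩_{μ₀} - γ ∫₀^∞ ⟨f, K_s θ₀⟩ ds`** for every bond `i < N`
  (`r → ∞`: `⟨f, K_r E_{≤i}⟩ → 0`);
* `integral_kinCorr_current_near` — `f = θ₀` (`⟨θ₀, E_{≤i}⟩ = T²`): **`∫₀^∞ ⟨θ₀, K_s j_i⟩ = γ ∫₀^∞ C_N` for EVERY bond `i`**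
  (the sum rule `γ(∫A_N + ∫C_N) = T²`) — the kinetic-reading × current Green–Kubo integral is flat along the chain and is the
  cross-form Kubo value of `BoundaryKubo`;
* `integral_kinCorr_current_far` — `f = θ_N` (`⟨θ_N, E_{≤i}⟩ = 0`): `∫₀^∞ ⟨θ_N, K_s j_i⟩ = -γ ∫₀^∞ C_N` (time reversal of
  the cross kernel, `kinCorr_cross_symm`).

Kernel-level versions of the identities behind Kundu–Dhar–Narayan's open-chain Green–Kubo formula; the current–current
form `∫₀^∞ ⟨J, K_s J⟩ = γ²N² ∫₀^∞ C_N` and `∫₀^∞ C_N ≥ 0` follow in `…IncoherentBoundedCurrentKubo` (take `f = J`).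
No definitions; nothing here closes an item.
-/

noncomputable section

open MeasureTheory ProbabilityTheory Filter Topology Set
open scoped NNReal ENNReal
open Literature.MathematicalPhysics.KineticTheory.HeatConduction
open Literature.MathematicalPhysics.KineticTheory Literature.Probability.Process OscillatorChain
open Literature.MathematicalPhysics.KineticTheory.HeatConduction.HardTether (leftEnergy blockWeight)
open Summit.AtomisticToContinuum.FouriersLaw.Theorems.SubdiffusiveBondHeat
open Summit.AtomisticToContinuum.FouriersLaw.Theorems.BoundaryKubo.GibbsTtcf
  (contDiff_leftEnergy leftEnergy_nonneg leftEnergy_le_hamiltonian blockWeight_nonneg_le_one)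
open Summit.AtomisticToContinuum.FouriersLaw.Theorems.LightConeBondHeat (pinnedChain_abs_bondCurrent_le_exp)

namespace Summit.AtomisticToContinuum.FouriersLaw.Theorems.IncoherentBounded

section Mixed

variable {ω₂ lam β γ : ℝ} (hω : 0 < ω₂) (hl : 0 ≤ lam) (hβ : 0 < β) (hγ : 0 < γ) {T : ℝ} (hT : 0 < T) {N : ℕ}
include hω hl hβ hγ hT

omit hγ in
/-- The bond currents are integrable for every transition kernel `K_u(z, ·)` (`|j_i| ≤ C e^{ϑH}`, CEHR (3.4)). [folklore] -/
theorem integrable_bondCurrent_transitionKernel (hγ' : 0 ≤ γ) (i : Fin (N + 1)) (u : ℝ≥0) (z : PhaseSpace (N + 1)) :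
    Integrable ((pinnedChain ω₂ lam β γ).bondCurrent (N + 1) i) ((pinnedChain ω₂ lam β γ).transitionKernel (N + 1) T T u z) := by
  have hϑ0 : (0 : ℝ) < 1 / (4 * T) := by positivity
  have hϑ1 : 1 / (4 * T) < 1 / T := by rw [div_lt_div_iff₀ (by positivity) hT]; nlinarith
  exact integrable_of_abs_le_exp
    (pinnedChain_integrable_exp_mul_hamiltonian_transitionKernel hω hl hT hβ.le hγ' (Nat.succ_pos N) hϑ0 hϑ1 u z)
    (pinnedChain_continuous_bondCurrent ω₂ lam β γ (N + 1) i)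
    (fun y => pinnedChain_abs_bondCurrent_le_exp hω.le hl hβ.le γ (N + 1) hϑ0 i y)

omit hγ in
/-- An observable with `|f| ≤ C e^{H/(4T)}` is square-integrable under `μ_T` (`f² ≤ C² e^{H/(2T)}`). [folklore] -/
theorem integrable_sq_of_abs_le_exp {n : ℕ} {f : PhaseSpace n → ℝ} (hf : Continuous f) {Cf : ℝ}
    (hfb : ∀ y, |f y| ≤ Cf * Real.exp (1 / (4 * T) * (pinnedChain ω₂ lam β γ).hamiltonian n y)) :
    Integrable (fun y => f y ^ 2) ((pinnedChain ω₂ lam β γ).gibbsMeasure n T) := by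
  have h2ϑ : 2 * (1 / (4 * T)) < 1 / T := by
    rw [show 2 * (1 / (4 * T)) = 1 / (2 * T) by field_simp; ring, div_lt_div_iff₀ (by positivity) hT]; nlinarith
  refine integrable_of_abs_le_exp (pinnedChain_integrable_exp_mul_hamiltonian_gibbsMeasure hω hl hβ.le γ n hT h2ϑ)
    (hf.pow 2) (C := Cf ^ 2) fun y => ?_
  rw [abs_pow, show Cf ^ 2 * Real.exp (2 * (1 / (4 * T)) * (pinnedChain ω₂ lam β γ).hamiltonian n y) =
    (Cf * Real.exp (1 / (4 * T) * (pinnedChain ω₂ lam β γ).hamiltonian n y)) ^ 2 by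
      rw [mul_pow, ← Real.exp_nat_mul]; ring_nf]
  exact pow_le_pow_left₀ (abs_nonneg _) (hfb y) 2

/-- **Centred correlations are integrable on `(0, ∞)` at every size**: for continuous `f, g` of exponential class
(`|f|, |g| ≤ C e^{H/(4T)}`) with `∫ f dμ_T = 0`, `u ↦ ∫ f · K_u g dμ_T ∈ L¹(0,∞)` (exponential mixing at fixed `N`).
[cite: CuneoEckmannHairerReyBellet2018, Thm 2.13 (3)] -/
theorem corr_centred_integrableOn {f g : PhaseSpace (N + 1) → ℝ} (hf : Continuous f) (hg : Continuous g) {Cf Cg : ℝ}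
    (hfb : ∀ y, |f y| ≤ Cf * Real.exp (1 / (4 * T) * (pinnedChain ω₂ lam β γ).hamiltonian (N + 1) y))
    (hgb : ∀ y, |g y| ≤ Cg * Real.exp (1 / (4 * T) * (pinnedChain ω₂ lam β γ).hamiltonian (N + 1) y))
    (hf0 : ∫ z, f z ∂((pinnedChain ω₂ lam β γ).gibbsMeasure (N + 1) T) = 0) :
    IntegrableOn (fun u : ℝ => ∫ z, f z * (∫ y, g y ∂((pinnedChain ω₂ lam β γ).transitionKernel (N + 1) T T u.toNNReal z))
      ∂((pinnedChain ω₂ lam β γ).gibbsMeasure (N + 1) T)) (Ioi 0) := by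
  obtain ⟨C, c, hc, hb⟩ := corr_sub_exp_decay hω hl hβ hγ (Nat.succ_pos N) hT hf hg hfb hgb
  refine Integrable.mono' ((exp_neg_integrableOn_Ioi 0 hc).const_mul C)
    (measurable_corr hω hl hβ hγ hT hf hg).aestronglyMeasurable ?_
  refine (ae_restrict_iff' measurableSet_Ioi).2 (Eventually.of_forall fun u hu => ?_)
  have h := hb u.toNNReal
  rw [hf0, zero_mul, sub_zero, Real.coe_toNNReal _ (le_of_lt hu)] at h
  rw [Real.norm_eq_abs]
  exact h

/-- **Duhamel form of the mixed identity.** For a genuine bond `i < N`, a continuous observable `f` of exponential class,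
and `r ≥ 0`: `∫ f · K_r E_{≤i} dμ₀ - ∫ f E_{≤i} dμ₀ = -∫₀ʳ (γ ∫ f · K_s θ₀ dμ₀ + ∫ f · K_s j_i dμ₀) ds`
(Dynkin for `E_{≤i}` paired with `f ∈ L²(μ₀)`, `L E_{≤i} = γ(T - p₀²) - j_i`). [cite: KunduDharNarayan2009, arXiv:0809.4543 p. 3] -/
theorem leftEnergy_pairing_sub {i : Fin (N + 1)} (hi : i.val + 1 < N + 1) {f : PhaseSpace (N + 1) → ℝ} (hf : Continuous f)
    {Cf : ℝ} (hfb : ∀ y, |f y| ≤ Cf * Real.exp (1 / (4 * T) * (pinnedChain ω₂ lam β γ).hamiltonian (N + 1) y))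
    (r : ℝ) (hr : 0 ≤ r) :
    (∫ z, f z * (∫ y, leftEnergy (pinnedChain ω₂ lam β γ) (N + 1) i y
        ∂((pinnedChain ω₂ lam β γ).transitionKernel (N + 1) T T r.toNNReal z)) ∂((pinnedChain ω₂ lam β γ).gibbsMeasure (N + 1) T)) -
        ∫ z, f z * leftEnergy (pinnedChain ω₂ lam β γ) (N + 1) i z ∂((pinnedChain ω₂ lam β γ).gibbsMeasure (N + 1) T) =
      -∫ s in (0 : ℝ)..r,
        (γ * (∫ z, f z * (∫ y, (y.2 0 ^ 2 - T)
            ∂((pinnedChain ω₂ lam β γ).transitionKernel (N + 1) T T s.toNNReal z)) ∂((pinnedChain ω₂ lam β γ).gibbsMeasure (N + 1) T)) +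
          ∫ z, f z * (∫ y, (pinnedChain ω₂ lam β γ).bondCurrent (N + 1) i y
            ∂((pinnedChain ω₂ lam β γ).transitionKernel (N + 1) T T s.toNNReal z)) ∂((pinnedChain ω₂ lam β γ).gibbsMeasure (N + 1) T)) := by
  set P := pinnedChain ω₂ lam β γ with hP
  set μ := P.gibbsMeasure (N + 1) T with hμ
  haveI : IsProbabilityMeasure μ := pinnedChain_isProbabilityMeasure_gibbsMeasure hω hl hβ.le γ (N + 1) hT
  have hN : 0 < N + 1 := Nat.succ_pos N
  set θa : PhaseSpace (N + 1) → ℝ := fun y => y.2 0 ^ 2 - T with hθa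
  set E : PhaseSpace (N + 1) → ℝ := leftEnergy P (N + 1) i with hE
  set ℓ : PhaseSpace (N + 1) → ℝ := fun y => γ * (T - y.2 0 ^ 2) - P.bondCurrent (N + 1) i y with hℓ
  have hU0 : ∀ q, 0 ≤ P.U q := fun q => by
    show 0 ≤ ω₂ * q ^ 2 / 2 + lam * q ^ 4 / 4; positivity
  have hV0 : ∀ r, 0 ≤ P.V r := fun r => by
    show 0 ≤ r ^ 2 / 2 + β * r ^ 4 / 4; positivity
  have hH0 : ∀ y, 0 ≤ P.hamiltonian (N + 1) y := fun y => pinnedChain_hamiltonian_nonneg hω.le hl hβ.le γ (N + 1) y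
  have hθac : Continuous θa := by fun_prop
  have hjc : Continuous (P.bondCurrent (N + 1) i) := pinnedChain_continuous_bondCurrent ω₂ lam β γ (N + 1) i
  have hEc : Continuous E :=
    (contDiff_leftEnergy P (pinnedChain_contDiff_U ω₂ lam β γ) (pinnedChain_contDiff_V ω₂ lam β γ) (N + 1) i (n := 0)).continuous
  have hℓc : Continuous ℓ := by fun_prop
  have hinv : ∀ s : ℝ≥0, μ.bind (P.transitionKernel (N + 1) T T s) = μ := fun s =>
    pinnedChain_gibbsMeasure_bind_transitionKernel hω hl hβ.le hγ.le hN hT s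
  -- square-integrability under `μ`
  have hf2 : Integrable (fun y => f y ^ 2) μ := integrable_sq_of_abs_le_exp hω hl hβ hT hf hfb
  have hθa2 : Integrable (fun y => θa y ^ 2) μ := integrable_sq_kinObs hω hl hβ hT 0
  have hE2 : Integrable (fun y => E y ^ 2) μ :=
    pinnedChain_integrable_sq_of_abs_le hω hl hβ.le γ (N + 1) hT hEc (C := 1) fun y => by
      have h1 := leftEnergy_nonneg P hU0 hV0 (N + 1) i y
      have h2 := leftEnergy_le_hamiltonian P hU0 hV0 (N + 1) i y
      rw [abs_of_nonneg h1]
      nlinarith [hH0 y, sq_nonneg (P.hamiltonian (N + 1) y)]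
  have hj2 : Integrable (fun y => P.bondCurrent (N + 1) i y ^ 2) μ :=
    pinnedChain_integrable_sq_bondCurrent hω hl hβ.le γ (N + 1) hT i
  have hkin2 : Integrable (fun y : PhaseSpace (N + 1) => (γ * (T - (y.2 0) ^ 2)) ^ 2) μ :=
    pinnedChain_integrable_sq_kineticDeviation hω hl hβ.le γ (N + 1) hT γ T 0
  have hℓ2 : Integrable (fun y => ℓ y ^ 2) μ := by
    have hsum : Integrable (fun y : PhaseSpace (N + 1) => 2 * (γ * (T - (y.2 0) ^ 2)) ^ 2 + 2 * P.bondCurrent (N + 1) i y ^ 2) μ :=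
      (hkin2.const_mul 2).add (hj2.const_mul 2)
    refine hsum.mono' (hℓc.pow 2).aestronglyMeasurable (Eventually.of_forall fun y => ?_)
    rw [Real.norm_eq_abs, abs_of_nonneg (sq_nonneg _), hℓ]
    dsimp only
    nlinarith [sq_nonneg (γ * (T - y.2 0 ^ 2) + P.bondCurrent (N + 1) i y)]
  -- Dynkin for `E`, paired with `f`
  have hdyn : ∀ (r : ℝ≥0) (z : PhaseSpace (N + 1)), ∫ y, E y ∂(P.transitionKernel (N + 1) T T r z) - E z =
      ∫ s in (0 : ℝ)..(r : ℝ), ∫ y, ℓ y ∂(P.transitionKernel (N + 1) T T s.toNNReal z) := fun r z =>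
    pinnedChain_leftEnergy_dynkin hω hl hβ hγ hT hi r z
  have hpair := pinnedChain_integral_mul_act_sub_of_dynkin hω hl hβ.le hγ.le (N + 1) T T μ hinv hf.measurable
    hEc.measurable hℓc.measurable hf2 hE2 hℓ2 hdyn hr
  rw [hpair, ← intervalIntegral.integral_neg]
  refine intervalIntegral.integral_congr fun s _ => ?_
  -- pointwise in `s`
  have hIa := (pinnedChain_integrable_mul_act_of_invariant hω hl hβ.le hγ.le (N + 1) T T μ s.toNNReal (hinv _)
    hf.measurable hθac.measurable hf2 hθa2).1
  have hIj := (pinnedChain_integrable_mul_act_of_invariant hω hl hβ.le hγ.le (N + 1) T T μ s.toNNReal (hinv _)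
    hf.measurable hjc.measurable hf2 hj2).1
  rw [← integral_const_mul, ← integral_add (hIa.const_mul γ) hIj, ← integral_neg]
  refine integral_congr_ae (Eventually.of_forall fun z => ?_)
  have hka := integrable_kinObs_transitionKernel hω hl hβ.le hγ.le hN hT 0 s.toNNReal z
  have hkj := integrable_bondCurrent_transitionKernel hω hl hβ hT hγ.le i s.toNNReal z
  have hKℓ : ∫ y, ℓ y ∂(P.transitionKernel (N + 1) T T s.toNNReal z) =
      (-γ) * (∫ y, θa y ∂(P.transitionKernel (N + 1) T T s.toNNReal z)) -
        ∫ y, P.bondCurrent (N + 1) i y ∂(P.transitionKernel (N + 1) T T s.toNNReal z) := by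
    have hℓ' : (fun y => ℓ y) = fun y => (-γ) * θa y - P.bondCurrent (N + 1) i y := by
      funext y; simp only [hℓ, hθa]; ring
    rw [hℓ', integral_sub (hka.const_mul _) hkj, integral_const_mul]
  have hθa' : (∫ y, (y.2 0 ^ 2 - T) ∂(P.transitionKernel (N + 1) T T s.toNNReal z)) =
      ∫ y, θa y ∂(P.transitionKernel (N + 1) T T s.toNNReal z) := rfl
  simp only
  rw [hKℓ, hθa']
  ring

/-- **THE MIXED KUBO IDENTITY.** For every bond `i < N` of the `(N+1)`-site chain and every CENTRED continuous observable
`f` of exponential class (`|f| ≤ C e^{H/(4T)}`, `∫ f dμ₀ = 0`):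

  `∫₀^∞ ∫ f · K_s j_i dμ₀ ds = ∫ f E_{≤i} dμ₀ - γ ∫₀^∞ ∫ f · K_s θ₀ dμ₀ ds`

(`leftEnergy_pairing_sub` and `r → ∞`: `∫ f · K_r E_{≤i} dμ₀ → 0` by exponential mixing at fixed `N`, both kernels in
`L¹(0,∞)`). [cite: KunduDharNarayan2009, arXiv:0809.4543 p. 3] -/
theorem integral_corr_current_eq {i : Fin (N + 1)} (hi : i.val + 1 < N + 1) {f : PhaseSpace (N + 1) → ℝ}
    (hf : Continuous f) {Cf : ℝ}
    (hfb : ∀ y, |f y| ≤ Cf * Real.exp (1 / (4 * T) * (pinnedChain ω₂ lam β γ).hamiltonian (N + 1) y))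
    (hf0 : ∫ z, f z ∂((pinnedChain ω₂ lam β γ).gibbsMeasure (N + 1) T) = 0) :
    ∫ u in Ioi (0 : ℝ), ∫ z, f z * (∫ y, (pinnedChain ω₂ lam β γ).bondCurrent (N + 1) i y
        ∂((pinnedChain ω₂ lam β γ).transitionKernel (N + 1) T T u.toNNReal z)) ∂((pinnedChain ω₂ lam β γ).gibbsMeasure (N + 1) T) =
      (∫ z, f z * leftEnergy (pinnedChain ω₂ lam β γ) (N + 1) i z ∂((pinnedChain ω₂ lam β γ).gibbsMeasure (N + 1) T)) -
        γ * ∫ u in Ioi (0 : ℝ), ∫ z, f z * (∫ y, (y.2 0 ^ 2 - T)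
          ∂((pinnedChain ω₂ lam β γ).transitionKernel (N + 1) T T u.toNNReal z)) ∂((pinnedChain ω₂ lam β γ).gibbsMeasure (N + 1) T) := by
  set P := pinnedChain ω₂ lam β γ with hP
  set μ := P.gibbsMeasure (N + 1) T with hμ
  haveI : IsProbabilityMeasure μ := pinnedChain_isProbabilityMeasure_gibbsMeasure hω hl hβ.le γ (N + 1) hT
  have hN : 0 < N + 1 := Nat.succ_pos N
  set cE : ℝ := ∫ z, f z * leftEnergy P (N + 1) i z ∂μ with hcE
  set 𝒜 : ℝ → ℝ := fun u => ∫ z, f z * (∫ y, (y.2 0 ^ 2 - T) ∂(P.transitionKernel (N + 1) T T u.toNNReal z)) ∂μ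
    with h𝒜
  set 𝒥 : ℝ → ℝ := fun u => ∫ z, f z * (∫ y, P.bondCurrent (N + 1) i y ∂(P.transitionKernel (N + 1) T T u.toNNReal z)) ∂μ
    with h𝒥
  set S : ℝ → ℝ := fun r => ∫ z, f z * (∫ y, leftEnergy P (N + 1) i y ∂(P.transitionKernel (N + 1) T T r.toNNReal z)) ∂μ
    with hS
  have hϑ0 : (0 : ℝ) < 1 / (4 * T) := by positivity
  have hIA : IntegrableOn 𝒜 (Ioi 0) :=
    corr_centred_integrableOn hω hl hβ hγ hT hf (by fun_prop) hfb
      (fun y => abs_sq_momentum_sub_le_exp hω hl hβ.le hϑ0 hT.le y 0) hf0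
  have hIJ : IntegrableOn 𝒥 (Ioi 0) :=
    corr_centred_integrableOn hω hl hβ hγ hT hf (pinnedChain_continuous_bondCurrent ω₂ lam β γ (N + 1) i) hfb
      (fun y => pinnedChain_abs_bondCurrent_le_exp hω.le hl hβ.le γ (N + 1) hϑ0 i y) hf0
  have hlim1 : Tendsto (fun r : ℝ => ∫ s in (0:ℝ)..r, (γ * 𝒜 s + 𝒥 s)) atTop
      (𝓝 (γ * (∫ u in Ioi (0:ℝ), 𝒜 u) + ∫ u in Ioi (0:ℝ), 𝒥 u)) := by
    rw [← integral_const_mul, ← integral_add (hIA.const_mul γ) hIJ]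
    exact intervalIntegral_tendsto_integral_Ioi 0 ((hIA.const_mul γ).add hIJ) tendsto_id
  -- `S(r) → 0`
  have hU0 : ∀ q, 0 ≤ P.U q := fun q => by
    show 0 ≤ ω₂ * q ^ 2 / 2 + lam * q ^ 4 / 4; positivity
  have hV0 : ∀ r, 0 ≤ P.V r := fun r => by
    show 0 ≤ r ^ 2 / 2 + β * r ^ 4 / 4; positivity
  have hEb : ∀ y, |leftEnergy P (N + 1) i y| ≤ (4 * T) * Real.exp (1 / (4 * T) * P.hamiltonian (N + 1) y) := fun y => by
    rw [abs_of_nonneg (leftEnergy_nonneg P hU0 hV0 (N + 1) i y)]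
    refine (leftEnergy_le_hamiltonian P hU0 hV0 (N + 1) i y).trans ?_
    have h := hamiltonian_le_exp (ω₂ := ω₂) (lam := lam) (β := β) (γ := γ) (n := N + 1) hϑ0 y
    rw [le_div_iff₀ hϑ0] at h
    have e : 4 * T * Real.exp (1 / (4 * T) * P.hamiltonian (N + 1) y) =
        Real.exp (1 / (4 * T) * P.hamiltonian (N + 1) y) * (4 * T) := mul_comm _ _
    rw [e]
    calc P.hamiltonian (N + 1) y = P.hamiltonian (N + 1) y * (1 / (4 * T)) * (4 * T) := by field_simp
      _ ≤ Real.exp (1 / (4 * T) * P.hamiltonian (N + 1) y) * (4 * T) := mul_le_mul_of_nonneg_right h (by positivity)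
  have hEc : Continuous (leftEnergy P (N + 1) i) :=
    (contDiff_leftEnergy P (pinnedChain_contDiff_U ω₂ lam β γ) (pinnedChain_contDiff_V ω₂ lam β γ) (N + 1) i (n := 0)).continuous
  obtain ⟨C, c, hc, hdec⟩ := corr_sub_exp_decay hω hl hβ hγ hN hT hf hEc hfb hEb
  have hS0 : Tendsto S atTop (𝓝 0) := by
    have hbound : ∀ᶠ r : ℝ in atTop, ‖S r‖ ≤ C * Real.exp (-c * r) := by
      filter_upwards [eventually_ge_atTop 0] with r hr
      have h := hdec r.toNNReal
      rw [hf0, zero_mul, sub_zero, Real.coe_toNNReal _ hr] at h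
      rw [Real.norm_eq_abs]
      exact h
    refine squeeze_zero_norm' hbound ?_
    have : Tendsto (fun r : ℝ => -c * r) atTop atBot := tendsto_id.const_mul_atTop_of_neg (by linarith)
    simpa using (Real.tendsto_exp_atBot.comp this).const_mul C
  have hlim2 : Tendsto (fun r : ℝ => ∫ s in (0:ℝ)..r, (γ * 𝒜 s + 𝒥 s)) atTop (𝓝 (cE - 0)) := by
    have hev : (fun r : ℝ => cE - S r) =ᶠ[atTop] fun r : ℝ => ∫ s in (0:ℝ)..r, (γ * 𝒜 s + 𝒥 s) := by
      filter_upwards [eventually_ge_atTop 0] with r hr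
      have h := leftEnergy_pairing_sub hω hl hβ hγ hT hi hf hfb r hr
      change S r - cE = -∫ s in (0:ℝ)..r, (γ * 𝒜 s + 𝒥 s) at h
      linarith
    exact (tendsto_const_nhds.sub hS0).congr' hev
  have heq := tendsto_nhds_unique hlim1 hlim2
  change ∫ u in Ioi (0:ℝ), 𝒥 u = cE - γ * ∫ u in Ioi (0:ℝ), 𝒜 u
  linarith

/-- **Near contact: `∫₀^∞ ⟨θ₀, K_s j_i⟩ ds = γ ∫₀^∞ C_N` for EVERY bond `i`** — the kinetic-reading × current Green–Kubo
integral is the same for all bonds and equals `γ` times the item's integrated cross kernel (the mixed identity with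
`f = θ₀`, `⟨θ₀, E_{≤i}⟩ = T²`, and the sum rule `γ(∫ A_N + ∫ C_N) = T²`). [cite: KunduDharNarayan2009, arXiv:0809.4543 p. 3] -/
theorem integral_kinCorr_current_near {i : Fin (N + 1)} (hi : i.val + 1 < N + 1) :
    ∫ u in Ioi (0 : ℝ), ∫ z, (z.2 0 ^ 2 - T) * (∫ y, (pinnedChain ω₂ lam β γ).bondCurrent (N + 1) i y
        ∂((pinnedChain ω₂ lam β γ).transitionKernel (N + 1) T T u.toNNReal z)) ∂((pinnedChain ω₂ lam β γ).gibbsMeasure (N + 1) T) =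
      γ * ∫ u in Ioi (0 : ℝ), ∫ z, (z.2 0 ^ 2 - T) * (∫ y, (y.2 (Fin.last N) ^ 2 - T)
        ∂((pinnedChain ω₂ lam β γ).transitionKernel (N + 1) T T u.toNNReal z)) ∂((pinnedChain ω₂ lam β γ).gibbsMeasure (N + 1) T) := by
  have hϑ0 : (0 : ℝ) < 1 / (4 * T) := by positivity
  have h := integral_corr_current_eq hω hl hβ hγ hT hi (f := fun z : PhaseSpace (N + 1) => z.2 0 ^ 2 - T) (by fun_prop)
    (fun y => abs_sq_momentum_sub_le_exp hω hl hβ.le hϑ0 hT.le y 0) (integral_kinObs_gibbsMeasure hω hl hβ hT 0)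
  have hw : blockWeight i (0 : Fin (N + 1)) = 1 := by
    unfold blockWeight; rw [if_pos]; exact Nat.zero_le _
  have hstat := integral_kinObs_mul_leftEnergy hω hl hβ (γ := γ) hT i (0 : Fin (N + 1))
  rw [hw, one_mul] at hstat
  have hs := sumRule_kinCorr hω hl hβ hγ (Nat.succ_pos N) hT
  have ha : (⟨0, Nat.succ_pos N⟩ : Fin (N + 1)) = 0 := rfl
  have hb : (⟨N + 1 - 1, Nat.sub_lt (Nat.succ_pos N) one_pos⟩ : Fin (N + 1)) = Fin.last N := rfl
  rw [ha, hb] at hs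
  rw [h, hstat]
  linarith

/-- **Far contact: `∫₀^∞ ⟨θ_N, K_s j_i⟩ ds = -γ ∫₀^∞ C_N` for every bond `i` and `N ≥ 1`** (the mixed identity with `f = θ_N`,
`⟨θ_N, E_{≤i}⟩ = 0` since site `N` lies right of every block, and the time-reversal symmetry of the cross kernel).
[cite: KunduDharNarayan2009, arXiv:0809.4543 p. 3] -/
theorem integral_kinCorr_current_far (hN1 : 1 ≤ N) {i : Fin (N + 1)} (hi : i.val + 1 < N + 1) :
    ∫ u in Ioi (0 : ℝ), ∫ z, (z.2 (Fin.last N) ^ 2 - T) * (∫ y, (pinnedChain ω₂ lam β γ).bondCurrent (N + 1) i y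
        ∂((pinnedChain ω₂ lam β γ).transitionKernel (N + 1) T T u.toNNReal z)) ∂((pinnedChain ω₂ lam β γ).gibbsMeasure (N + 1) T) =
      -γ * ∫ u in Ioi (0 : ℝ), ∫ z, (z.2 0 ^ 2 - T) * (∫ y, (y.2 (Fin.last N) ^ 2 - T)
        ∂((pinnedChain ω₂ lam β γ).transitionKernel (N + 1) T T u.toNNReal z)) ∂((pinnedChain ω₂ lam β γ).gibbsMeasure (N + 1) T) := by
  have hϑ0 : (0 : ℝ) < 1 / (4 * T) := by positivity
  have h := integral_corr_current_eq hω hl hβ hγ hT hi (f := fun z : PhaseSpace (N + 1) => z.2 (Fin.last N) ^ 2 - T)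
    (by fun_prop) (fun y => abs_sq_momentum_sub_le_exp hω hl hβ.le hϑ0 hT.le y (Fin.last N))
    (integral_kinObs_gibbsMeasure hω hl hβ hT (Fin.last N))
  have hw : blockWeight i (Fin.last N) = 0 := by
    unfold blockWeight; rw [if_neg]; simp only [Fin.val_last]; omega
  have hstat := integral_kinObs_mul_leftEnergy hω hl hβ (γ := γ) hT i (Fin.last N)
  rw [hw, zero_mul] at hstat
  have hn2 : 2 ≤ N + 1 := by omega
  have hTR : ∫ u in Ioi (0 : ℝ), ∫ z, (z.2 (Fin.last N) ^ 2 - T) * (∫ y, (y.2 0 ^ 2 - T)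
      ∂((pinnedChain ω₂ lam β γ).transitionKernel (N + 1) T T u.toNNReal z)) ∂((pinnedChain ω₂ lam β γ).gibbsMeasure (N + 1) T) =
      ∫ u in Ioi (0 : ℝ), ∫ z, (z.2 0 ^ 2 - T) * (∫ y, (y.2 (Fin.last N) ^ 2 - T)
      ∂((pinnedChain ω₂ lam β γ).transitionKernel (N + 1) T T u.toNNReal z)) ∂((pinnedChain ω₂ lam β γ).gibbsMeasure (N + 1) T) :=
    setIntegral_congr_fun measurableSet_Ioi fun u hu =>
      kinCorr_cross_symm hω hl hβ hγ hn2 hT 0 (Fin.last N) (le_of_lt hu)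
  rw [h, hstat, hTR]
  ring

end Mixed

end Summit.AtomisticToContinuum.FouriersLaw.Theorems.IncoherentBounded

end
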